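import Summits.QuantumAdvantage.QuantumAdvantage.Theorems.CharDialStrataDialC
import Summits.QuantumAdvantage.QuantumAdvantage.Theorems.CharDialIslandDialC
import HarnessLib

/-!
# CharDialGammaDialB — TREE PART B of the decomp-qadv lens-5 g32 node «GammaDial» on `CharDial.FrobStructureLawOdd`
# (stmt-QuantumAdvantage-27205): §2 the Möbius strata of a weight indicator `u ↦ [hh(wt_R u)]` are the binomial transforms of
# `hh` (`moeb_weight`; top stratum = residue count, stratum `p − 2` = `−Σ(z+1)[hh z]`, stratum `p − 3` doubled = `Σ(z+1)(z+2)[hh z]`),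
# and §3 the slices of an `R`-exchangeable class member over its block: in the table form `f(u) = H(u|_{Rᶜ}, wt_R u)` the row
# `H(x,·)` has residue count `γ` (`resCount_row`) and its first/second moments are affine/quadratic on the free cube `X ∖ R`
# (`mom1_row`, `mom2_row`), by the slice formula `StrataDial.chi_slice` and `TopConst`.

Verbatim `section Weight` and `section Slices` of the node file (namespace `Theorems.GammaDial`); definitions `mom1`, `mom2`,
`onesZ` (plain `def`s, no instances, no notation); no `sorry`.
-/

set_option autoImplicit false
set_option linter.dupNamespace false

namespace Summit.QuantumAdvantage.QuantumAdvantage.Theorems.GammaDial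

open Finset
open Summit.QuantumAdvantage.AdviceFreeQNC0
open Literature.Computability.MetaComplexity Literature.Computability.MetaComplexity.Smolensky
open Summit.QuantumAdvantage.QuantumAdvantage.Theorems.IslandDial (Relevant Exch TopConst NormalForm ExchCoreAt ExchCoreOdd IslandAt
  IslandOdd exchCoreOdd_of_target islandOdd_of_target exch_weight_form)
open Summit.QuantumAdvantage.QuantumAdvantage.Theorems.TableDial (TabLaw TabAt TabOdd tabLaw_all_of_core tabAt_iff_all tabOdd_of_target)
open Summit.QuantumAdvantage.QuantumAdvantage.Theorems.StrataDial (SwapInv exchCoreAt_iff_tabAt chi chi_slice chi_eq_zero_of_card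
  chi_eq_zero_of_not_subset comp_swap_eq_self)

/-! ### §2 Möbius strata of a weight indicator `u ↦ [hh (wt_R u)]` (binomial transforms of `hh`) -/

section Weight

variable {p : ℕ} [hp : Fact p.Prime] {n : ℕ}

/-- `2·C(p−3, s) ≡ (−1)^s (s+1)(s+2) (mod p)` for `s ≤ p − 3`. -/
theorem two_mul_choose_pred3_prime_cast (p : ℕ) [hp : Fact p.Prime] : ∀ s : ℕ, s ≤ p - 3 →
    2 * (((p - 3).choose s : ℕ) : ZMod p) = (-1) ^ s * (((s : ZMod p) + 1) * ((s : ZMod p) + 2)) := by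
  intro s
  induction s with
  | zero => intro _; norm_num
  | succ s ih =>
    intro hs
    have h1 : (p - 3).choose s + (p - 3).choose (s + 1) = (p - 2).choose (s + 1) := by
      have h := Nat.choose_succ_succ' (p - 3) s
      rw [show p - 3 + 1 = p - 2 by omega] at h
      omega
    have h2 : 2 * (((p - 3).choose s : ℕ) : ZMod p) + 2 * (((p - 3).choose (s + 1) : ℕ) : ZMod p)
        = 2 * ((-1) ^ (s + 1) * (((s + 1 : ℕ) : ZMod p) + 1)) := by
      rw [← mul_add, ← Nat.cast_add, h1, SubChar.choose_predpred_prime_cast p (s + 1) (by omega)]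
    rw [eq_sub_of_add_eq' h2, ih (by omega), pow_succ]
    push_cast
    ring

/-- The Möbius coefficient of `u ↦ [hh (wt_R u)]` at `S ⊆ R` is the binomial transform of `t ↦ [hh t]` at `|S|`. -/
theorem moeb_weight (hh : ZMod p → Bool) {R S : Finset (Fin n)} (hS : S ⊆ R) :
    SubLog.moeb (fun u => if hh ((SubChar.bw R u : ℕ) : ZMod p) then (1 : ZMod p) else 0) S =
      ∑ t ∈ Finset.range (S.card + 1),
        ((S.card.choose t : ℕ) : ZMod p) * ((-1) ^ (S.card - t) * (if hh (t : ZMod p) then (1 : ZMod p) else 0)) := by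
  classical
  unfold SubLog.moeb
  have h1 : ∀ T ∈ S.powerset, (-1 : ZMod p) ^ (S.card - T.card) *
      (fun u => if hh ((SubChar.bw R u : ℕ) : ZMod p) then (1 : ZMod p) else 0) (SubLog.vert T) =
        (fun t : ℕ => (-1 : ZMod p) ^ (S.card - t) * (if hh (t : ZMod p) then (1 : ZMod p) else 0)) T.card := by
    intro T hT
    have hTR : T ∩ R = T := Finset.inter_eq_left.2 ((Finset.mem_powerset.1 hT).trans hS)
    simp only [SubChar.bw_vert, hTR]
  rw [Finset.sum_congr rfl h1, Finset.sum_powerset_apply_card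
    (fun t : ℕ => (-1 : ZMod p) ^ (S.card - t) * (if hh (t : ZMod p) then (1 : ZMod p) else 0))]
  refine Finset.sum_congr rfl fun t _ => ?_
  rw [nsmul_eq_mul]

/-- First moment of a residue predicate: `Σ_z z·[hh z]`. -/
def mom1 (hh : ZMod p → Bool) : ZMod p := ∑ z : ZMod p, if hh z then z else 0

/-- Second moment of a residue predicate: `Σ_z z²·[hh z]`. -/
def mom2 (hh : ZMod p → Bool) : ZMod p := ∑ z : ZMod p, if hh z then z ^ 2 else 0

/-- TOP STRATUM (`|T| = p − 1`, `p` odd): the Möbius coefficient is the residue count `#{z : hh z}`. -/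
theorem moeb_weight_top (hp2 : p ≠ 2) (hh : ZMod p → Bool) {R T : Finset (Fin n)} (hT : T ⊆ R) (hc : T.card = p - 1) :
    SubLog.moeb (fun u => if hh ((SubChar.bw R u : ℕ) : ZMod p) then (1 : ZMod p) else 0) T = SubChar.resCount hh := by
  have hp1 : 1 < p := hp.out.one_lt
  rw [moeb_weight hh hT, hc, Nat.sub_add_cancel hp1.le]
  have h1 : ∀ t ∈ Finset.range p, (((p - 1).choose t : ℕ) : ZMod p) * ((-1) ^ (p - 1 - t) * (if hh (t : ZMod p) then (1 : ZMod p) else 0))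
      = (fun z : ZMod p => if hh z then (1 : ZMod p) else 0) (t : ZMod p) := by
    intro t ht
    have ht' : t < p := Finset.mem_range.1 ht
    rw [SubChar.choose_pred_prime_cast p t ht', ← mul_assoc, ← pow_add, show t + (p - 1 - t) = p - 1 by omega,
      Even.neg_one_pow (hp.out.even_sub_one hp2), one_mul]
  rw [Finset.sum_congr rfl h1, SubChar.sum_range_eq_sum_zmod (fun z : ZMod p => if hh z then (1 : ZMod p) else 0)]
  rfl

/-- The weighted indicator sums appearing in the strata `p − 2`, `p − 3`. -/
theorem sum_succ_mul_ind (hh : ZMod p → Bool) :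
    ∑ z : ZMod p, (z + 1) * (if hh z then (1 : ZMod p) else 0) = mom1 hh + SubChar.resCount hh := by
  unfold mom1 SubChar.resCount
  rw [← Finset.sum_add_distrib]
  refine Finset.sum_congr rfl fun z _ => ?_
  split_ifs <;> ring

/-- `Σ_z (z+1)(z+2)[hh z] = mom2 + 3·mom1 + 2·resCount`. -/
theorem sum_succ_mul_succ_mul_ind (hh : ZMod p → Bool) :
    ∑ z : ZMod p, (z + 1) * (z + 2) * (if hh z then (1 : ZMod p) else 0) =
      mom2 hh + 3 * mom1 hh + 2 * SubChar.resCount hh := by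
  unfold mom1 mom2 SubChar.resCount
  rw [Finset.mul_sum, Finset.mul_sum, ← Finset.sum_add_distrib, ← Finset.sum_add_distrib]
  refine Finset.sum_congr rfl fun z _ => ?_
  split_ifs <;> ring

/-- `((p - 1 : ℕ) : 𝔽_p) + 1 = 0`. -/
theorem cast_pred_add_one : ((p - 1 : ℕ) : ZMod p) + 1 = 0 := by
  have : ((p - 1 : ℕ) : ZMod p) + 1 = ((p - 1 + 1 : ℕ) : ZMod p) := by push_cast; ring
  rw [this, Nat.sub_add_cancel hp.out.one_lt.le, ZMod.natCast_self]

/-- `((p - 2 : ℕ) : 𝔽_p) + 2 = 0` (`p ≥ 2`). -/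
theorem cast_predpred_add_two : ((p - 2 : ℕ) : ZMod p) + 2 = 0 := by
  have : ((p - 2 : ℕ) : ZMod p) + 2 = ((p - 2 + 2 : ℕ) : ZMod p) := by push_cast; ring
  rw [this, Nat.sub_add_cancel hp.out.two_le, ZMod.natCast_self]

/-- STRATUM `p − 2` (`p` odd): the Möbius coefficient is `−Σ_z (z+1)[hh z] = −(mom1 + resCount)`. -/
theorem moeb_weight_sub1 (hp2 : p ≠ 2) (hh : ZMod p → Bool) {R S : Finset (Fin n)} (hS : S ⊆ R) (hc : S.card = p - 2) :
    SubLog.moeb (fun u => if hh ((SubChar.bw R u : ℕ) : ZMod p) then (1 : ZMod p) else 0) S =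
      -(mom1 hh + SubChar.resCount hh) := by
  have hp3 : 3 ≤ p := by have := hp.out.two_le; omega
  have hodd : Odd (p - 2) := Nat.Odd.sub_even (by omega) (hp.out.odd_of_ne_two hp2) even_two
  rw [moeb_weight hh hS, hc, show p - 2 + 1 = p - 1 by omega]
  let G : ZMod p → ZMod p := fun z => (z + 1) * (if hh z then (1 : ZMod p) else 0)
  have h1 : ∀ t ∈ Finset.range (p - 1), (((p - 2).choose t : ℕ) : ZMod p) *
      ((-1) ^ (p - 2 - t) * (if hh (t : ZMod p) then (1 : ZMod p) else 0)) = -G (t : ZMod p) := by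
    intro t ht
    have ht' : t ≤ p - 2 := by have := Finset.mem_range.1 ht; omega
    rw [SubChar.choose_predpred_prime_cast p t ht']
    have key : (-1 : ZMod p) ^ t * (-1) ^ (p - 2 - t) = -1 := by
      rw [← pow_add, show t + (p - 2 - t) = p - 2 by omega, Odd.neg_one_pow hodd]
    show (-1 : ZMod p) ^ t * ((t : ZMod p) + 1) * ((-1) ^ (p - 2 - t) * (if hh (t : ZMod p) then (1 : ZMod p) else 0))
      = -(((t : ZMod p) + 1) * (if hh (t : ZMod p) then (1 : ZMod p) else 0))
    linear_combination ((t : ZMod p) + 1) * (if hh (t : ZMod p) then (1 : ZMod p) else 0) * key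
  rw [Finset.sum_congr rfl h1, Finset.sum_neg_distrib]
  have e : ∑ t ∈ Finset.range p, G (t : ZMod p) = ∑ t ∈ Finset.range (p - 1), G (t : ZMod p) := by
    conv_lhs => rw [show Finset.range p = Finset.range (p - 1 + 1) by rw [Nat.sub_add_cancel hp.out.one_lt.le]]
    rw [Finset.sum_range_succ]
    have : G ((p - 1 : ℕ) : ZMod p) = 0 := by
      show (((p - 1 : ℕ) : ZMod p) + 1) * _ = 0
      rw [cast_pred_add_one, zero_mul]
    rw [this, add_zero]
  rw [← e, SubChar.sum_range_eq_sum_zmod G, sum_succ_mul_ind]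

/-- STRATUM `p − 3` (`p` odd), doubled: `2·μ = Σ_z (z+1)(z+2)[hh z] = mom2 + 3·mom1 + 2·resCount`. -/
theorem two_mul_moeb_weight_sub2 (hp2 : p ≠ 2) (hh : ZMod p → Bool) {R S : Finset (Fin n)} (hS : S ⊆ R)
    (hc : S.card = p - 3) :
    2 * SubLog.moeb (fun u => if hh ((SubChar.bw R u : ℕ) : ZMod p) then (1 : ZMod p) else 0) S =
      mom2 hh + 3 * mom1 hh + 2 * SubChar.resCount hh := by
  have hp3 : 3 ≤ p := by have := hp.out.two_le; omega
  have heven : Even (p - 3) := Nat.Odd.sub_odd (hp.out.odd_of_ne_two hp2) (by decide : Odd 3)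
  rw [moeb_weight hh hS, hc, show p - 3 + 1 = p - 2 by omega, Finset.mul_sum]
  let G : ZMod p → ZMod p := fun z => (z + 1) * (z + 2) * (if hh z then (1 : ZMod p) else 0)
  have h1 : ∀ t ∈ Finset.range (p - 2), 2 * ((((p - 3).choose t : ℕ) : ZMod p) *
      ((-1) ^ (p - 3 - t) * (if hh (t : ZMod p) then (1 : ZMod p) else 0))) = G (t : ZMod p) := by
    intro t ht
    have ht' : t ≤ p - 3 := by have := Finset.mem_range.1 ht; omega
    rw [← mul_assoc, two_mul_choose_pred3_prime_cast p t ht']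
    have key : (-1 : ZMod p) ^ t * (-1) ^ (p - 3 - t) = 1 := by
      rw [← pow_add, show t + (p - 3 - t) = p - 3 by omega, Even.neg_one_pow heven]
    show (-1 : ZMod p) ^ t * (((t : ZMod p) + 1) * ((t : ZMod p) + 2)) *
        ((-1) ^ (p - 3 - t) * (if hh (t : ZMod p) then (1 : ZMod p) else 0))
      = ((t : ZMod p) + 1) * ((t : ZMod p) + 2) * (if hh (t : ZMod p) then (1 : ZMod p) else 0)
    linear_combination ((t : ZMod p) + 1) * ((t : ZMod p) + 2) * (if hh (t : ZMod p) then (1 : ZMod p) else 0) * key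
  rw [Finset.sum_congr rfl h1]
  have e : ∑ t ∈ Finset.range p, G (t : ZMod p) = ∑ t ∈ Finset.range (p - 2), G (t : ZMod p) := by
    conv_lhs => rw [show Finset.range p = Finset.range (p - 2 + 1 + 1) by rw [show p - 2 + 1 + 1 = p by omega]]
    rw [Finset.sum_range_succ, Finset.sum_range_succ]
    have h₁ : G ((p - 2 : ℕ) : ZMod p) = 0 := by
      show (((p - 2 : ℕ) : ZMod p) + 1) * (((p - 2 : ℕ) : ZMod p) + 2) * _ = 0
      rw [cast_predpred_add_two, mul_zero, zero_mul]
    have h₂ : G ((p - 2 + 1 : ℕ) : ZMod p) = 0 := by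
      show (((p - 2 + 1 : ℕ) : ZMod p) + 1) * (((p - 2 + 1 : ℕ) : ZMod p) + 2) * _ = 0
      rw [show p - 2 + 1 = p - 1 by omega, cast_pred_add_one, zero_mul, zero_mul]
    rw [h₁, h₂, add_zero, add_zero]
  rw [← e, SubChar.sum_range_eq_sum_zmod G, sum_succ_mul_succ_mul_ind]

end Weight

/-! ### §3 Slices of an `R`-exchangeable class member over its block `R`: the row predicate and its first strata -/

section Slices

variable {p : ℕ} [hp : Fact p.Prime] {n : ℕ}

/-- Sum over a powerset split by cardinality `0`, `1`, `≥ 2`. -/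
theorem sum_powerset_split {M : Type*} [AddCommMonoid M] (W : Finset (Fin n)) (g : Finset (Fin n) → M) :
    ∑ U ∈ W.powerset, g U = g ∅ + ∑ k ∈ W, g {k} + ∑ U ∈ W.powerset.filter (fun U => 2 ≤ U.card), g U := by
  classical
  rw [← Finset.sum_filter_add_sum_filter_not W.powerset (fun U => 2 ≤ U.card), add_comm]
  congr 1
  have hsplit : W.powerset.filter (fun U => ¬ 2 ≤ U.card) = W.powersetCard 0 ∪ W.powersetCard 1 := by
    ext U
    simp only [Finset.mem_filter, Finset.mem_powerset, Finset.mem_union, Finset.mem_powersetCard]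
    constructor
    · rintro ⟨h1, h2⟩
      by_cases h0 : U.card = 0
      · exact Or.inl ⟨h1, h0⟩
      · exact Or.inr ⟨h1, by omega⟩
    · rintro (⟨h1, h2⟩ | ⟨h1, h2⟩) <;> exact ⟨h1, by omega⟩
  have hdis : Disjoint (W.powersetCard 0) (W.powersetCard 1) :=
    Finset.disjoint_left.2 fun U h0 h1 => by
      rw [Finset.mem_powersetCard] at h0 h1
      omega
  rw [hsplit, Finset.sum_union hdis, Finset.powersetCard_zero, Finset.sum_singleton, Finset.powersetCard_one, Finset.sum_map]
  rfl

/-- … and the `≥ 2` part split into `= 2` and `≥ 3`. -/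
theorem sum_filter_two_split {M : Type*} [AddCommMonoid M] (W : Finset (Fin n)) (g : Finset (Fin n) → M) :
    ∑ U ∈ W.powerset.filter (fun U => 2 ≤ U.card), g U =
      ∑ U ∈ W.powersetCard 2, g U + ∑ U ∈ W.powerset.filter (fun U => 3 ≤ U.card), g U := by
  classical
  rw [← Finset.sum_filter_add_sum_filter_not (W.powerset.filter (fun U => 2 ≤ U.card)) (fun U => 3 ≤ U.card), add_comm,
    Finset.filter_filter, Finset.filter_filter]
  congr 1
  · congr 1
    ext U
    simp only [Finset.mem_filter, Finset.mem_powerset, Finset.mem_powersetCard]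
    constructor
    · rintro ⟨h1, h2, h3⟩; exact ⟨h1, by omega⟩
    · rintro ⟨h1, h2⟩; exact ⟨h1, by omega, by omega⟩
  · congr 1
    ext U
    simp only [Finset.mem_filter, Finset.mem_powerset]
    constructor
    · rintro ⟨h1, _, h3⟩; exact ⟨h1, h3⟩
    · rintro ⟨h1, h3⟩; exact ⟨h1, by omega, h3⟩

variable {f : (Fin n → Bool) → Bool} {X R : Finset (Fin n)} {γ : ZMod p} {H : (Fin n → Bool) → ZMod p → Bool}

/-- The ones of `x` among the free coordinates `X ∖ R` of the table. -/
def onesZ (X R : Finset (Fin n)) (x : Fin n → Bool) : Finset (Fin n) := (X \ R).filter fun k => x k = true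

/-- The free ones lie in the free coordinates. -/
theorem onesZ_subset (x : Fin n → Bool) : onesZ X R x ⊆ X \ R := Finset.filter_subset _ _

/-- Membership in the free ones. -/
theorem mem_onesZ {x : Fin n → Bool} {k : Fin n} : k ∈ onesZ X R x ↔ (k ∈ X ∧ k ∉ R) ∧ x k = true := by
  simp [onesZ, Finset.mem_sdiff]

/-- A block set `T ⊆ R` and a free set `U ⊆ X ∖ R` are disjoint, so `|T ∪ U| = |T| + |U|`. -/
theorem card_union_free {T U : Finset (Fin n)} (hT : T ⊆ R) (hU : U ⊆ X \ R) : (T ∪ U).card = T.card + U.card := by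
  rw [Finset.card_union_of_disjoint]
  exact Finset.disjoint_left.2 fun k hkT hkU => (Finset.mem_sdiff.1 (hU hkU)).2 (hT hkT)

/-- THE SLICE AS A WEIGHT INDICATOR: over `R` at base point `x` the slice of `f` is `u ↦ [H(x|_{Rᶜ}, wt_R u)]`. -/
theorem slice_eq_weight (hH : ∀ u, f u = H (JLin.proj (Finset.univ \ R) u) ((SubChar.bw R u : ℕ) : ZMod p))
    (x : Fin n → Bool) :
    (fun u => f (SubLog.merge R u x)) = fun u => H (JLin.proj (Finset.univ \ R) x) ((SubChar.bw R u : ℕ) : ZMod p) := by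
  funext u
  rw [hH]
  have h1 : JLin.proj (Finset.univ \ R) (SubLog.merge R u x) = JLin.proj (Finset.univ \ R) x := by
    funext i
    unfold JLin.proj SubLog.merge
    by_cases hi : i ∈ Finset.univ \ R
    · have hiR : i ∉ R := (Finset.mem_sdiff.1 hi).2
      rw [if_pos hi, if_pos hi, if_neg hiR]
    · rw [if_neg hi, if_neg hi]
  have h2 : SubChar.bw R (SubLog.merge R u x) = SubChar.bw R u :=
    SubChar.bw_congr fun i hi => by simp [SubLog.merge, hi]
  rw [h1, h2]

/-- The Möbius strata of the slice at `T ⊆ R` are the binomial transforms of the ROW predicate `H(x|_{Rᶜ}, ·)` … -/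
theorem chi_slice_row (hH : ∀ u, f u = H (JLin.proj (Finset.univ \ R) u) ((SubChar.bw R u : ℕ) : ZMod p))
    (x : Fin n → Bool) (T : Finset (Fin n)) :
    chi p (fun u => f (SubLog.merge R u x)) T =
      SubLog.moeb (fun u => if H (JLin.proj (Finset.univ \ R) x) ((SubChar.bw R u : ℕ) : ZMod p) then (1 : ZMod p) else 0) T := by
  show SubLog.moeb (SubLog.indR (ZMod p) (fun u => f (SubLog.merge R u x))) T = _
  rw [slice_eq_weight hH x]
  rfl

/-- … and, by the slice formula (`StrataDial.chi_slice`), sums of strata of `f` over the free ones of `x` INSIDE `X`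
(free coordinates outside `X` contribute nothing, `f` being a function of `X`). -/
theorem chi_slice_onesZ (hdep : DependsOn f (↑X : Set (Fin n))) (x : Fin n → Bool) {T : Finset (Fin n)}
    (hT : T ⊆ R) : chi p (fun u => f (SubLog.merge R u x)) T = ∑ U ∈ (onesZ X R x).powerset, chi p f (T ∪ U) := by
  classical
  rw [chi_slice f R x hT]
  symm
  refine Finset.sum_subset (Finset.powerset_mono.2 fun k hk => ?_) fun U hU hUW => ?_
  · rw [mem_onesZ] at hk
    exact Finset.mem_filter.2 ⟨Finset.mem_sdiff.2 ⟨Finset.mem_univ _, hk.1.2⟩, hk.2⟩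
  · have hUO := Finset.mem_powerset.1 hU
    obtain ⟨k, hkU, hkW⟩ := Finset.not_subset.1 (fun h => hUW (Finset.mem_powerset.2 h))
    have hkO := Finset.mem_filter.1 (hUO hkU)
    have hkR : k ∉ R := (Finset.mem_sdiff.1 hkO.1).2
    have hkX : k ∉ X := fun hkX => hkW (mem_onesZ.2 ⟨⟨hkX, hkR⟩, hkO.2⟩)
    exact chi_eq_zero_of_not_subset hdep fun hsub => hkX (hsub (Finset.mem_union_right _ hkU))

/-- ROW COUNT (stratum `p − 1`): every row of the table has `γ` residues (in `𝔽_p`): `#{s : H(x|_{Rᶜ}, s)} = γ`. -/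
theorem resCount_row (hp2 : p ≠ 2) (hRX : R ⊆ X) (hR : p - 1 ≤ R.card) (hdep : DependsOn f (↑X : Set (Fin n)))
    (hf : HasDegF p f (p - 1)) (htop : TopConst p f X γ)
    (hH : ∀ u, f u = H (JLin.proj (Finset.univ \ R) u) ((SubChar.bw R u : ℕ) : ZMod p)) (x : Fin n → Bool) :
    SubChar.resCount (H (JLin.proj (Finset.univ \ R) x)) = γ := by
  classical
  obtain ⟨T, hTR, hTc⟩ := Finset.exists_subset_card_eq hR
  rw [← moeb_weight_top hp2 _ hTR hTc, ← chi_slice_row hH x T, chi_slice_onesZ hdep x hTR,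
    Finset.sum_eq_single_of_mem ∅ (Finset.empty_mem_powerset _) fun U hU hne => ?_]
  · rw [Finset.union_empty]
    exact htop T (hTR.trans hRX) hTc
  · refine chi_eq_zero_of_card hf ?_
    rw [card_union_free hTR ((Finset.mem_powerset.1 hU).trans (onesZ_subset x)), hTc]
    have := Finset.nonempty_iff_ne_empty.2 hne
    have := this.card_pos
    have := hp.out.one_lt
    omega

/-- ROW SUM (stratum `p − 2`): `−(Σ_s (s+1)[H(x|_{Rᶜ}, s)]) = χ_f(S) + γ·#onesZ(x)` for any `S ⊆ R`, `|S| = p − 2`. -/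
theorem mom1_row (hp2 : p ≠ 2) (hRX : R ⊆ X) (hdep : DependsOn f (↑X : Set (Fin n))) (hf : HasDegF p f (p - 1))
    (htop : TopConst p f X γ) (hH : ∀ u, f u = H (JLin.proj (Finset.univ \ R) u) ((SubChar.bw R u : ℕ) : ZMod p))
    {S : Finset (Fin n)} (hS : S ⊆ R) (hSc : S.card = p - 2) (x : Fin n → Bool) :
    -(mom1 (H (JLin.proj (Finset.univ \ R) x)) + SubChar.resCount (H (JLin.proj (Finset.univ \ R) x))) =
      chi p f S + ((onesZ X R x).card : ZMod p) * γ := by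
  classical
  have hp3 : 3 ≤ p := by have := hp.out.two_le; omega
  rw [← moeb_weight_sub1 hp2 _ hS hSc, ← chi_slice_row hH x S, chi_slice_onesZ hdep x hS, sum_powerset_split,
    Finset.union_empty]
  have h1 : ∀ k ∈ onesZ X R x, chi p f (S ∪ {k}) = γ := by
    intro k hk
    have hk' := (mem_onesZ.1 hk).1
    refine htop _ (Finset.union_subset (hS.trans hRX) (Finset.singleton_subset_iff.2 hk'.1)) ?_
    rw [card_union_free hS (Finset.singleton_subset_iff.2 (Finset.mem_sdiff.2 hk')), hSc, Finset.card_singleton]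
    omega
  have h2 : ∀ U ∈ (onesZ X R x).powerset.filter (fun U => 2 ≤ U.card), chi p f (S ∪ U) = 0 := by
    intro U hU
    have hU' := Finset.mem_filter.1 hU
    refine chi_eq_zero_of_card hf ?_
    rw [card_union_free hS ((Finset.mem_powerset.1 hU'.1).trans (onesZ_subset x)), hSc]
    omega
  rw [Finset.sum_congr rfl h1, Finset.sum_congr rfl h2, Finset.sum_const, Finset.sum_const_zero, add_zero, nsmul_eq_mul]

/-- ROW SECOND MOMENT (stratum `p − 3`): `Σ_s (s+1)(s+2)[H(x|_{Rᶜ}, s)] = 2(χ_f(S') + Σ_{k ∈ onesZ x} χ_f(S' ∪ k) + C(#onesZ x, 2)·γ)`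
for any `S' ⊆ R`, `|S'| = p − 3`. -/
theorem mom2_row (hp2 : p ≠ 2) (hRX : R ⊆ X) (hdep : DependsOn f (↑X : Set (Fin n))) (hf : HasDegF p f (p - 1))
    (htop : TopConst p f X γ) (hH : ∀ u, f u = H (JLin.proj (Finset.univ \ R) u) ((SubChar.bw R u : ℕ) : ZMod p))
    {S : Finset (Fin n)} (hS : S ⊆ R) (hSc : S.card = p - 3) (x : Fin n → Bool) :
    mom2 (H (JLin.proj (Finset.univ \ R) x)) + 3 * mom1 (H (JLin.proj (Finset.univ \ R) x)) +
        2 * SubChar.resCount (H (JLin.proj (Finset.univ \ R) x)) =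
      2 * (chi p f S + ∑ k ∈ onesZ X R x, chi p f (S ∪ {k}) + (((onesZ X R x).card.choose 2 : ℕ) : ZMod p) * γ) := by
  classical
  have hp3 : 3 ≤ p := by have := hp.out.two_le; omega
  rw [← two_mul_moeb_weight_sub2 hp2 _ hS hSc, ← chi_slice_row hH x S, chi_slice_onesZ hdep x hS, sum_powerset_split,
    Finset.union_empty, sum_filter_two_split]
  have h2 : ∀ U ∈ (onesZ X R x).powersetCard 2, chi p f (S ∪ U) = γ := by
    intro U hU
    have hU' := Finset.mem_powersetCard.1 hU
    refine htop _ (Finset.union_subset (hS.trans hRX) (hU'.1.trans ((onesZ_subset x).trans Finset.sdiff_subset))) ?_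
    rw [card_union_free hS (hU'.1.trans (onesZ_subset x)), hSc, hU'.2]
    omega
  have h3 : ∀ U ∈ (onesZ X R x).powerset.filter (fun U => 3 ≤ U.card), chi p f (S ∪ U) = 0 := by
    intro U hU
    have hU' := Finset.mem_filter.1 hU
    refine chi_eq_zero_of_card hf ?_
    rw [card_union_free hS ((Finset.mem_powerset.1 hU'.1).trans (onesZ_subset x)), hSc]
    omega
  rw [Finset.sum_congr rfl h2, Finset.sum_congr rfl h3, Finset.sum_const, Finset.sum_const_zero, add_zero,
    Finset.card_powersetCard, nsmul_eq_mul]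

end Slices

end Summit.QuantumAdvantage.QuantumAdvantage.Theorems.GammaDial
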